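import Literature.IUT.HodgeTheaters.Cor53iModelHkerOfMonoidRigidity
import Literature.IUT.HodgeTheaters.GlobalFrobenioidsArithmeticWhiskeredCor411
import Literature.AlgebraicGeometry.Frobenioids.ArithDivisorMonoidRigidOfPrincipal
import HarnessLib

/-!
# [IUTchI] Cor 5.3 (i) «respectively `⊚`»: `hker⊚` at the base-changed models `ℱ(Φ ∘ S, 𝔹 ∘ S, Div ∘ S)` of `†ℱ^⊚` from
# Φ-RIGID-PRINC (PROVED) and the Ex 5.1 (v) unit-ratio law alone

S. Mochizuki, *Inter-universal Teichmüller theory I*, kurims manuscript (May 2020), §5 Cor 5.3 (i) p. 144 l. 2–11 («resp. `⊚`») and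
its proof l. 24–33; Ex 5.1 (iii) pp. 125–126, (v)/(vi) pp. 127–130 ([IUTchI] Cor 5.3 (i) p.144) [claim: Mochizuki2012, status: disputed]
(nothing of the series is asserted; no side taken on [IUTchIII] Cor. 3.12); [FrdI] Thm 5.2 (i) p. 100, Cor 4.11 pp. 91–92, Prop 1.6
p. 27 [cite: MochizukiFrdI2008, Thm. 5.2(i) p.100].

PROOF-ONLY (cell abc-iut, seat abc-iut-L5-t11 gen 16, row «C53I-FCIRC-HKER» file F2, abc-iut-L5-lead RULINGS #154 (2b)).  The
realization `†ℱ^⊚ ⊆ †ℱ^⊛` of the Frobenioid attached to `†𝔉_mod` is, up to equivalence over `†𝒟^⊚ = ℬ(H)⁰`, the model Frobenioid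
of the WHISKERED divisor data `(Φ ∘ S, 𝔹 ∘ S, Div ∘ S)` along the subfield functor `S : ℬ(H)⁰ ⥤ FinSubextCat F F̄` ([FrdI] Prop 1.6
base change; the transport to abc-iut-L5-t4's record carrier `𝓕.fcircBase` is file F3).  Here this seat's GENERIC engine
★ `Cor53iModelHkerOfMonoidRigidity` (`Cor53.model_rigidOverBase_of_divMonoidRigid_of_ratioRigid`) is fed, at that data and for
`H` slim, with: the [FrdI] Cor 4.11 package of ★ `GlobalFrobenioidsArithmeticWhiskeredCor411` (file F1: `hypotheses_whisker`,
`preservesDegFr_whisker`, `exists_oneUniqueSquare_base_whisker`, `exists_cor411iv_data_whisker`, `hasUnder/underUnique_modelBase_whisker`)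
and Φ-RIGID-PRINC objectwise (abc-iut-L5-t1 R82 ★ `EffArithDivisor.mulEquiv_apply_eq_self_of_map_principal` — the monoids
`(Φ ∘ S)(A) = Φ(S A)` are the same effective arithmetic divisor monoids).  RESULT **`Cor53.whisker_rigidOverBase_of_ratioRigid (hZ) (hB)`**:
`RigidOverBase` of the base functor of the base-changed model — the (k2) binder `hker⊚` of ★ `Cor53TelescopeCensusKnit` in model
form — from 𝔹-RATIO⊚ ALONE, plus the §0 descend corollaries.  CENSUS of the `⊚`-slot (model form): `hker⊚ ⟸` LAW 0 · [FrdI]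
Cor 4.11 (ii)/(iii)/(iv) PROVED · Φ-RIGID-PRINC PROVED · FACT-SHAPE 1 {𝔹-RATIO⊚ ≙ F-2577} · side {IsSlimGroup H}.
HONEST TAGS: 𝔹-RATIO⊚ and `hlift⊚` displayed, not proved; no token moves on this file alone; typed ≠ proved; nothing here asserts
abc proved or refuted.
-/

noncomputable section

set_option backward.isDefEq.respectTransparency false

namespace Literature.IUT.HodgeTheaters

open CategoryTheory Opposite NumberField
open Literature.AlgebraicGeometry.Frobenioids Literature.AnabelianGeometry.SemiGraphs
open Literature.AlgebraicGeometry.Frobenioids.QuasiTemperoid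
open Literature.AlgebraicGeometry.Frobenioids.PreFrobenioid

/-! ### §1. The model inputs at the whiskered data `(Φ ∘ S, 𝔹 ∘ S, Div ∘ S)` over `ℬ(H)⁰`, `H` slim -/

namespace GlobalDivisorData

section Whisker

variable {H : ProfiniteGrp.{0}} (F : Type) [Field F] [NumberField F] (S : BaseCat H ⥤ FinSubextCat F (Fbar F))

/-- **Φ-RIGID-PRINC at the whiskered data** — objectwise the SAME monoids as at `ℱ^⊛(†𝒟^⊚)` (`(Φ ∘ S)(A) = Φ(S A)`), so
abc-iut-L5-t1 gen 13's R82 theorem `EffArithDivisor.mulEquiv_apply_eq_self_of_map_principal` discharges it by the same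
one-liner as at `GlobalDivisorData.arith F`. [cite: MochizukiFrdI2008, Ex. 6.3 p.113] -/
theorem whisker_divMonoid_eq_self_of_map_divB (A : BaseCat H)
    (θ : (GlobalDivisorData.mk (S.op ⋙ arithDivisorFunctor F (Fbar F)) (S.op ⋙ unitsFunctor F (Fbar F))
        (Functor.whiskerLeft S.op (divNatTrans F (Fbar F))) : GlobalDivisorData H).Φ.obj (op A) ≃*
      (GlobalDivisorData.mk (S.op ⋙ arithDivisorFunctor F (Fbar F)) (S.op ⋙ unitsFunctor F (Fbar F))
        (Functor.whiskerLeft S.op (divNatTrans F (Fbar F))) : GlobalDivisorData H).Φ.obj (op A))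
    (hθ : ∀ w : (GlobalDivisorData.mk (S.op ⋙ arithDivisorFunctor F (Fbar F)) (S.op ⋙ unitsFunctor F (Fbar F))
        (Functor.whiskerLeft S.op (divNatTrans F (Fbar F))) : GlobalDivisorData H).B.obj (op A),
      MonGp.map θ.toMonoidHom (divB (GlobalDivisorData.mk (S.op ⋙ arithDivisorFunctor F (Fbar F)) (S.op ⋙ unitsFunctor F (Fbar F))
        (Functor.whiskerLeft S.op (divNatTrans F (Fbar F))) : GlobalDivisorData H).Φ
          (GlobalDivisorData.mk (S.op ⋙ arithDivisorFunctor F (Fbar F)) (S.op ⋙ unitsFunctor F (Fbar F))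
        (Functor.whiskerLeft S.op (divNatTrans F (Fbar F))) : GlobalDivisorData H).B
          (GlobalDivisorData.mk (S.op ⋙ arithDivisorFunctor F (Fbar F)) (S.op ⋙ unitsFunctor F (Fbar F))
        (Functor.whiskerLeft S.op (divNatTrans F (Fbar F))) : GlobalDivisorData H).div (op A) w) =
        divB (GlobalDivisorData.mk (S.op ⋙ arithDivisorFunctor F (Fbar F)) (S.op ⋙ unitsFunctor F (Fbar F))
        (Functor.whiskerLeft S.op (divNatTrans F (Fbar F))) : GlobalDivisorData H).Φ
          (GlobalDivisorData.mk (S.op ⋙ arithDivisorFunctor F (Fbar F)) (S.op ⋙ unitsFunctor F (Fbar F))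
        (Functor.whiskerLeft S.op (divNatTrans F (Fbar F))) : GlobalDivisorData H).B
          (GlobalDivisorData.mk (S.op ⋙ arithDivisorFunctor F (Fbar F)) (S.op ⋙ unitsFunctor F (Fbar F))
        (Functor.whiskerLeft S.op (divNatTrans F (Fbar F))) : GlobalDivisorData H).div (op A) w) :
    ∀ x, θ x = x :=
  fun x => EffArithDivisor.mulEquiv_apply_eq_self_of_map_principal θ hθ x

/-- **`Ψ ⋙ Base` is rigid** for every self-equivalence of the base-changed model ([FrdI] Cor 4.11 (ii), `H` slim — file F1's
`exists_oneUniqueSquare_base_whisker`). ([IUTchI] Ex 5.1 (iii) p.126) [cite: MochizukiFrdI2008, Cor. 4.11 (ii) p.91] [claim: Mochizuki2012, status: disputed] -/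
theorem whisker_isRigid_comp_modelBase (hZ : IsSlimGroup H)
    (Ψ : (GlobalDivisorData.mk (S.op ⋙ arithDivisorFunctor F (Fbar F)) (S.op ⋙ unitsFunctor F (Fbar F))
        (Functor.whiskerLeft S.op (divNatTrans F (Fbar F))) : GlobalDivisorData H).ModelGlobalFrobenioid ≌
      (GlobalDivisorData.mk (S.op ⋙ arithDivisorFunctor F (Fbar F)) (S.op ⋙ unitsFunctor F (Fbar F))
        (Functor.whiskerLeft S.op (divNatTrans F (Fbar F))) : GlobalDivisorData H).ModelGlobalFrobenioid) :
    IsRigidFunctor (Ψ.functor ⋙ (GlobalDivisorData.mk (S.op ⋙ arithDivisorFunctor F (Fbar F)) (S.op ⋙ unitsFunctor F (Fbar F))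
        (Functor.whiskerLeft S.op (divNatTrans F (Fbar F))) : GlobalDivisorData H).modelBase) := by
  obtain ⟨-, -, h, -⟩ := exists_oneUniqueSquare_base_whisker F S S hZ hZ Ψ
  exact h

/-- **Zero divisors of a self-equivalence of the base-changed model OVER THE IDENTITY move through a natural automorphism `θ_Ψ`
of `Φ ∘ S` over `𝟭` and a base identification `η'`** ([FrdI] Cor 4.11 (iv), file F1's `exists_cor411iv_data_whisker`, through the
generic `model_exists_divAut_of_overBase`). ([IUTchI] Cor 5.3 (i) p.144) [cite: MochizukiFrdI2008, Cor. 4.11 (iv) p.92] [claim: Mochizuki2012, status: disputed] -/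
theorem whisker_exists_divAut_of_overBase (hZ : IsSlimGroup H)
    (Ψ : (GlobalDivisorData.mk (S.op ⋙ arithDivisorFunctor F (Fbar F)) (S.op ⋙ unitsFunctor F (Fbar F))
        (Functor.whiskerLeft S.op (divNatTrans F (Fbar F))) : GlobalDivisorData H).ModelGlobalFrobenioid ≌
      (GlobalDivisorData.mk (S.op ⋙ arithDivisorFunctor F (Fbar F)) (S.op ⋙ unitsFunctor F (Fbar F))
        (Functor.whiskerLeft S.op (divNatTrans F (Fbar F))) : GlobalDivisorData H).ModelGlobalFrobenioid)
    (h : Nonempty (Ψ.functor ⋙ (GlobalDivisorData.mk (S.op ⋙ arithDivisorFunctor F (Fbar F)) (S.op ⋙ unitsFunctor F (Fbar F))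
        (Functor.whiskerLeft S.op (divNatTrans F (Fbar F))) : GlobalDivisorData H).modelBase ≅
      (GlobalDivisorData.mk (S.op ⋙ arithDivisorFunctor F (Fbar F)) (S.op ⋙ unitsFunctor F (Fbar F))
        (Functor.whiskerLeft S.op (divNatTrans F (Fbar F))) : GlobalDivisorData H).modelBase)) :
    ∃ (θ : (ModelFrobenioid.data (GlobalDivisorData.mk (S.op ⋙ arithDivisorFunctor F (Fbar F)) (S.op ⋙ unitsFunctor F (Fbar F))
        (Functor.whiskerLeft S.op (divNatTrans F (Fbar F))) : GlobalDivisorData H).Φ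
          (GlobalDivisorData.mk (S.op ⋙ arithDivisorFunctor F (Fbar F)) (S.op ⋙ unitsFunctor F (Fbar F))
        (Functor.whiskerLeft S.op (divNatTrans F (Fbar F))) : GlobalDivisorData H).B
          (GlobalDivisorData.mk (S.op ⋙ arithDivisorFunctor F (Fbar F)) (S.op ⋙ unitsFunctor F (Fbar F))
        (Functor.whiskerLeft S.op (divNatTrans F (Fbar F))) : GlobalDivisorData H).div).DivisorMonoidIsoOverBase
        (ModelFrobenioid.data (GlobalDivisorData.mk (S.op ⋙ arithDivisorFunctor F (Fbar F)) (S.op ⋙ unitsFunctor F (Fbar F))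
        (Functor.whiskerLeft S.op (divNatTrans F (Fbar F))) : GlobalDivisorData H).Φ
          (GlobalDivisorData.mk (S.op ⋙ arithDivisorFunctor F (Fbar F)) (S.op ⋙ unitsFunctor F (Fbar F))
        (Functor.whiskerLeft S.op (divNatTrans F (Fbar F))) : GlobalDivisorData H).B
          (GlobalDivisorData.mk (S.op ⋙ arithDivisorFunctor F (Fbar F)) (S.op ⋙ unitsFunctor F (Fbar F))
        (Functor.whiskerLeft S.op (divNatTrans F (Fbar F))) : GlobalDivisorData H).div) (𝟭 (BaseCat H)))
      (η' : Ψ.functor ⋙ (GlobalDivisorData.mk (S.op ⋙ arithDivisorFunctor F (Fbar F)) (S.op ⋙ unitsFunctor F (Fbar F))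
        (Functor.whiskerLeft S.op (divNatTrans F (Fbar F))) : GlobalDivisorData H).modelBase ≅
        (GlobalDivisorData.mk (S.op ⋙ arithDivisorFunctor F (Fbar F)) (S.op ⋙ unitsFunctor F (Fbar F))
        (Functor.whiskerLeft S.op (divNatTrans F (Fbar F))) : GlobalDivisorData H).modelBase),
      ∀ ⦃A B : (GlobalDivisorData.mk (S.op ⋙ arithDivisorFunctor F (Fbar F)) (S.op ⋙ unitsFunctor F (Fbar F))
        (Functor.whiskerLeft S.op (divNatTrans F (Fbar F))) : GlobalDivisorData H).ModelGlobalFrobenioid⦄ (φ : A ⟶ B),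
        ModelFrobenioid.div (Ψ.functor.map φ) =
          pull (GlobalDivisorData.mk (S.op ⋙ arithDivisorFunctor F (Fbar F)) (S.op ⋙ unitsFunctor F (Fbar F))
        (Functor.whiskerLeft S.op (divNatTrans F (Fbar F))) : GlobalDivisorData H).Φ (η'.hom.app A)
            (θ.iso A.base (ModelFrobenioid.div φ)) := by
  obtain ⟨ΨBase, E', η, hsq, -, hdivE, -, -, -⟩ := exists_cor411iv_data_whisker F S S hZ hZ Ψ
  exact model_exists_divAut_of_overBase _ Ψ E' η hsq hdivE h

end Whisker

end GlobalDivisorData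

/-! ### §2. `hker⊚` at the base-changed model from 𝔹-RATIO⊚ alone; the descend corollaries -/

namespace Cor53

section Whisker

variable {H : ProfiniteGrp.{0}} (F : Type) [Field F] [NumberField F] (S : BaseCat H ⥤ FinSubextCat F (Fbar F))

/-- **[IUTchI] Cor 5.3 (i) «resp. `⊚`», injectivity content at the base-changed model `ℱ(Φ ∘ S, 𝔹 ∘ S, Div ∘ S)` over `ℬ(H)⁰`, `H`
slim — `RigidOverBase` of its base functor (`hker⊚`, model form) from ONE displayed binder `hB` = 𝔹-RATIO⊚** (print's Ex 5.1 (v):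
every self-equivalence over the identity of `†𝒟^⊚` preserves, through some base identification, the birational units of parallel
linear arrows — FACT-SHAPE); everything else ([FrdI] Cor 4.11 (ii)/(iii)/(iv), group-like `𝔹`, Φ-RIGID-PRINC) is PROVED and fed to the
generic `model_rigidOverBase_of_divMonoidRigid_of_ratioRigid`. ([IUTchI] Cor 5.3 (i) p.144) [claim: Mochizuki2012, status: disputed] -/
theorem whisker_rigidOverBase_of_ratioRigid (hZ : IsSlimGroup H)
    (hB : ∀ Ψ : (GlobalDivisorData.mk (S.op ⋙ arithDivisorFunctor F (Fbar F)) (S.op ⋙ unitsFunctor F (Fbar F))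
        (Functor.whiskerLeft S.op (divNatTrans F (Fbar F))) : GlobalDivisorData H).ModelGlobalFrobenioid ≌
        (GlobalDivisorData.mk (S.op ⋙ arithDivisorFunctor F (Fbar F)) (S.op ⋙ unitsFunctor F (Fbar F))
        (Functor.whiskerLeft S.op (divNatTrans F (Fbar F))) : GlobalDivisorData H).ModelGlobalFrobenioid,
      Nonempty (Ψ.functor ⋙ (GlobalDivisorData.mk (S.op ⋙ arithDivisorFunctor F (Fbar F)) (S.op ⋙ unitsFunctor F (Fbar F))
        (Functor.whiskerLeft S.op (divNatTrans F (Fbar F))) : GlobalDivisorData H).modelBase ≅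
        (GlobalDivisorData.mk (S.op ⋙ arithDivisorFunctor F (Fbar F)) (S.op ⋙ unitsFunctor F (Fbar F))
        (Functor.whiskerLeft S.op (divNatTrans F (Fbar F))) : GlobalDivisorData H).modelBase) →
      ∃ η : Ψ.functor ⋙ (GlobalDivisorData.mk (S.op ⋙ arithDivisorFunctor F (Fbar F)) (S.op ⋙ unitsFunctor F (Fbar F))
        (Functor.whiskerLeft S.op (divNatTrans F (Fbar F))) : GlobalDivisorData H).modelBase ≅
        (GlobalDivisorData.mk (S.op ⋙ arithDivisorFunctor F (Fbar F)) (S.op ⋙ unitsFunctor F (Fbar F))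
        (Functor.whiskerLeft S.op (divNatTrans F (Fbar F))) : GlobalDivisorData H).modelBase,
        ∀ ⦃X Y : (GlobalDivisorData.mk (S.op ⋙ arithDivisorFunctor F (Fbar F)) (S.op ⋙ unitsFunctor F (Fbar F))
        (Functor.whiskerLeft S.op (divNatTrans F (Fbar F))) : GlobalDivisorData H).ModelGlobalFrobenioid⦄ (f g : X ⟶ Y),
          ModelFrobenioid.degFr f = 1 → ModelFrobenioid.degFr g = 1 → ModelFrobenioid.baseMap f = ModelFrobenioid.baseMap g →
            ModelFrobenioid.unit (Ψ.functor.map f) *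
                pull (GlobalDivisorData.mk (S.op ⋙ arithDivisorFunctor F (Fbar F)) (S.op ⋙ unitsFunctor F (Fbar F))
        (Functor.whiskerLeft S.op (divNatTrans F (Fbar F))) : GlobalDivisorData H).B (A := X.base) (B := (Ψ.functor.obj X).base) (η.hom.app X)
                  (ModelFrobenioid.unit g) =
              ModelFrobenioid.unit (Ψ.functor.map g) *
                pull (GlobalDivisorData.mk (S.op ⋙ arithDivisorFunctor F (Fbar F)) (S.op ⋙ unitsFunctor F (Fbar F))
        (Functor.whiskerLeft S.op (divNatTrans F (Fbar F))) : GlobalDivisorData H).B (A := X.base) (B := (Ψ.functor.obj X).base) (η.hom.app X)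
                  (ModelFrobenioid.unit f)) :
    CatIsomorphism.RigidOverBase (GlobalDivisorData.mk (S.op ⋙ arithDivisorFunctor F (Fbar F)) (S.op ⋙ unitsFunctor F (Fbar F))
        (Functor.whiskerLeft S.op (divNatTrans F (Fbar F))) : GlobalDivisorData H).modelBase :=
  model_rigidOverBase_of_divMonoidRigid_of_ratioRigid _
    (fun A b => ((GlobalDivisorData.hypotheses_whisker F S).isGroupLike_rat (unop A)).isUnit b)
    (GlobalDivisorData.preservesDegFr_whisker F S S hZ hZ) (GlobalDivisorData.whisker_isRigid_comp_modelBase F S hZ)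
    (GlobalDivisorData.whisker_exists_divAut_of_overBase F S hZ) (GlobalDivisorData.whisker_divMonoid_eq_self_of_map_divB F S) hB

/-- **[IUTchI] Cor 5.3 (i) «resp. `⊚`», INJECTIVITY of `Aut(ℱ^⊚) → Aut(†𝒟^⊚)` at the base-changed model** (the §0 natural map over
file F1's `hasUnder_modelBase_whisker` / `underUnique_modelBase_whisker`) from 𝔹-RATIO⊚ alone. ([IUTchI] Cor 5.3 (i) p.144)
[claim: Mochizuki2012, status: disputed] -/
theorem whisker_descend_injective_of_ratioRigid (hZ : IsSlimGroup H)
    (hB : ∀ Ψ : (GlobalDivisorData.mk (S.op ⋙ arithDivisorFunctor F (Fbar F)) (S.op ⋙ unitsFunctor F (Fbar F))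
        (Functor.whiskerLeft S.op (divNatTrans F (Fbar F))) : GlobalDivisorData H).ModelGlobalFrobenioid ≌
        (GlobalDivisorData.mk (S.op ⋙ arithDivisorFunctor F (Fbar F)) (S.op ⋙ unitsFunctor F (Fbar F))
        (Functor.whiskerLeft S.op (divNatTrans F (Fbar F))) : GlobalDivisorData H).ModelGlobalFrobenioid,
      Nonempty (Ψ.functor ⋙ (GlobalDivisorData.mk (S.op ⋙ arithDivisorFunctor F (Fbar F)) (S.op ⋙ unitsFunctor F (Fbar F))
        (Functor.whiskerLeft S.op (divNatTrans F (Fbar F))) : GlobalDivisorData H).modelBase ≅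
        (GlobalDivisorData.mk (S.op ⋙ arithDivisorFunctor F (Fbar F)) (S.op ⋙ unitsFunctor F (Fbar F))
        (Functor.whiskerLeft S.op (divNatTrans F (Fbar F))) : GlobalDivisorData H).modelBase) →
      ∃ η : Ψ.functor ⋙ (GlobalDivisorData.mk (S.op ⋙ arithDivisorFunctor F (Fbar F)) (S.op ⋙ unitsFunctor F (Fbar F))
        (Functor.whiskerLeft S.op (divNatTrans F (Fbar F))) : GlobalDivisorData H).modelBase ≅
        (GlobalDivisorData.mk (S.op ⋙ arithDivisorFunctor F (Fbar F)) (S.op ⋙ unitsFunctor F (Fbar F))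
        (Functor.whiskerLeft S.op (divNatTrans F (Fbar F))) : GlobalDivisorData H).modelBase,
        ∀ ⦃X Y : (GlobalDivisorData.mk (S.op ⋙ arithDivisorFunctor F (Fbar F)) (S.op ⋙ unitsFunctor F (Fbar F))
        (Functor.whiskerLeft S.op (divNatTrans F (Fbar F))) : GlobalDivisorData H).ModelGlobalFrobenioid⦄ (f g : X ⟶ Y),
          ModelFrobenioid.degFr f = 1 → ModelFrobenioid.degFr g = 1 → ModelFrobenioid.baseMap f = ModelFrobenioid.baseMap g →
            ModelFrobenioid.unit (Ψ.functor.map f) *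
                pull (GlobalDivisorData.mk (S.op ⋙ arithDivisorFunctor F (Fbar F)) (S.op ⋙ unitsFunctor F (Fbar F))
        (Functor.whiskerLeft S.op (divNatTrans F (Fbar F))) : GlobalDivisorData H).B (A := X.base) (B := (Ψ.functor.obj X).base) (η.hom.app X)
                  (ModelFrobenioid.unit g) =
              ModelFrobenioid.unit (Ψ.functor.map g) *
                pull (GlobalDivisorData.mk (S.op ⋙ arithDivisorFunctor F (Fbar F)) (S.op ⋙ unitsFunctor F (Fbar F))
        (Functor.whiskerLeft S.op (divNatTrans F (Fbar F))) : GlobalDivisorData H).B (A := X.base) (B := (Ψ.functor.obj X).base) (η.hom.app X)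
                  (ModelFrobenioid.unit f)) :
    Function.Injective (CatIsomorphism.descend (GlobalDivisorData.hasUnder_modelBase_whisker F S S hZ hZ)
      (GlobalDivisorData.underUnique_modelBase_whisker F S S hZ hZ)) :=
  CatIsomorphism.descend_injective_of_kernel_trivial _ _ (whisker_rigidOverBase_of_ratioRigid F S hZ hB)

/-- **[IUTchI] Cor 5.3 (i) «resp. `⊚`» AS PRINTED («bijective») at the base-changed model**, from 𝔹-RATIO⊚ and the surjectivity
half `hlift⊚` (BY NAME; abc-iut-w4-d109's `Cor53iFcircLiftsAll` lane supplies it at the record carrier). ([IUTchI] Cor 5.3 (i) p.144)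
[claim: Mochizuki2012, status: disputed] -/
theorem whisker_descendBijective_of_ratioRigid_of_lifts (hZ : IsSlimGroup H)
    (hB : ∀ Ψ : (GlobalDivisorData.mk (S.op ⋙ arithDivisorFunctor F (Fbar F)) (S.op ⋙ unitsFunctor F (Fbar F))
        (Functor.whiskerLeft S.op (divNatTrans F (Fbar F))) : GlobalDivisorData H).ModelGlobalFrobenioid ≌
        (GlobalDivisorData.mk (S.op ⋙ arithDivisorFunctor F (Fbar F)) (S.op ⋙ unitsFunctor F (Fbar F))
        (Functor.whiskerLeft S.op (divNatTrans F (Fbar F))) : GlobalDivisorData H).ModelGlobalFrobenioid,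
      Nonempty (Ψ.functor ⋙ (GlobalDivisorData.mk (S.op ⋙ arithDivisorFunctor F (Fbar F)) (S.op ⋙ unitsFunctor F (Fbar F))
        (Functor.whiskerLeft S.op (divNatTrans F (Fbar F))) : GlobalDivisorData H).modelBase ≅
        (GlobalDivisorData.mk (S.op ⋙ arithDivisorFunctor F (Fbar F)) (S.op ⋙ unitsFunctor F (Fbar F))
        (Functor.whiskerLeft S.op (divNatTrans F (Fbar F))) : GlobalDivisorData H).modelBase) →
      ∃ η : Ψ.functor ⋙ (GlobalDivisorData.mk (S.op ⋙ arithDivisorFunctor F (Fbar F)) (S.op ⋙ unitsFunctor F (Fbar F))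
        (Functor.whiskerLeft S.op (divNatTrans F (Fbar F))) : GlobalDivisorData H).modelBase ≅
        (GlobalDivisorData.mk (S.op ⋙ arithDivisorFunctor F (Fbar F)) (S.op ⋙ unitsFunctor F (Fbar F))
        (Functor.whiskerLeft S.op (divNatTrans F (Fbar F))) : GlobalDivisorData H).modelBase,
        ∀ ⦃X Y : (GlobalDivisorData.mk (S.op ⋙ arithDivisorFunctor F (Fbar F)) (S.op ⋙ unitsFunctor F (Fbar F))
        (Functor.whiskerLeft S.op (divNatTrans F (Fbar F))) : GlobalDivisorData H).ModelGlobalFrobenioid⦄ (f g : X ⟶ Y),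
          ModelFrobenioid.degFr f = 1 → ModelFrobenioid.degFr g = 1 → ModelFrobenioid.baseMap f = ModelFrobenioid.baseMap g →
            ModelFrobenioid.unit (Ψ.functor.map f) *
                pull (GlobalDivisorData.mk (S.op ⋙ arithDivisorFunctor F (Fbar F)) (S.op ⋙ unitsFunctor F (Fbar F))
        (Functor.whiskerLeft S.op (divNatTrans F (Fbar F))) : GlobalDivisorData H).B (A := X.base) (B := (Ψ.functor.obj X).base) (η.hom.app X)
                  (ModelFrobenioid.unit g) =
              ModelFrobenioid.unit (Ψ.functor.map g) *
                pull (GlobalDivisorData.mk (S.op ⋙ arithDivisorFunctor F (Fbar F)) (S.op ⋙ unitsFunctor F (Fbar F))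
        (Functor.whiskerLeft S.op (divNatTrans F (Fbar F))) : GlobalDivisorData H).B (A := X.base) (B := (Ψ.functor.obj X).base) (η.hom.app X)
                  (ModelFrobenioid.unit f))
    (hlift : ∀ Θ : BaseCat H ≌ BaseCat H,
      ∃ Ψ : (GlobalDivisorData.mk (S.op ⋙ arithDivisorFunctor F (Fbar F)) (S.op ⋙ unitsFunctor F (Fbar F))
        (Functor.whiskerLeft S.op (divNatTrans F (Fbar F))) : GlobalDivisorData H).ModelGlobalFrobenioid ≌
        (GlobalDivisorData.mk (S.op ⋙ arithDivisorFunctor F (Fbar F)) (S.op ⋙ unitsFunctor F (Fbar F))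
        (Functor.whiskerLeft S.op (divNatTrans F (Fbar F))) : GlobalDivisorData H).ModelGlobalFrobenioid,
      Nonempty (CatIsomorphism.LiesUnder (GlobalDivisorData.mk (S.op ⋙ arithDivisorFunctor F (Fbar F)) (S.op ⋙ unitsFunctor F (Fbar F))
        (Functor.whiskerLeft S.op (divNatTrans F (Fbar F))) : GlobalDivisorData H).modelBase
        (GlobalDivisorData.mk (S.op ⋙ arithDivisorFunctor F (Fbar F)) (S.op ⋙ unitsFunctor F (Fbar F))
        (Functor.whiskerLeft S.op (divNatTrans F (Fbar F))) : GlobalDivisorData H).modelBase Ψ Θ)) :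
    CatIsomorphism.DescendBijective (GlobalDivisorData.mk (S.op ⋙ arithDivisorFunctor F (Fbar F)) (S.op ⋙ unitsFunctor F (Fbar F))
        (Functor.whiskerLeft S.op (divNatTrans F (Fbar F))) : GlobalDivisorData H).modelBase
      (GlobalDivisorData.mk (S.op ⋙ arithDivisorFunctor F (Fbar F)) (S.op ⋙ unitsFunctor F (Fbar F))
        (Functor.whiskerLeft S.op (divNatTrans F (Fbar F))) : GlobalDivisorData H).modelBase
      (GlobalDivisorData.hasUnder_modelBase_whisker F S S hZ hZ) (GlobalDivisorData.underUnique_modelBase_whisker F S S hZ hZ) :=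
  ⟨whisker_descend_injective_of_ratioRigid F S hZ hB, CatIsomorphism.descend_surjective_of_lifts _ _ hlift⟩

end Whisker

end Cor53

end Literature.IUT.HodgeTheaters

end
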